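/-
Copyright (c) 2026 the pub-hodgecm-mathlib formalisation cell (harness21).  Prover seat hodgecm-mathlib-K2E3-p37 (g2), Track B «K2-LIT» ∕ h413 =
`stmt-HodgeConjecture-24833`, line `K2_E3_EllipticInputs`, unit U4 «Keys», PART «U4Keys» socket :182 (U4f-χ₁-ram-one-pos)
`sig_K2E3KeysThmTwoContractingRamifiedCharOnePosDepth` (L4 line-lead K2E3-plan (g5); programme A_pos^{=} of this base's g0 memo
`K2/K2E3-p37/g0/CENSUS-U4f-PosDepth.K2E3-p37-g0.md` §6–§10): brick (iii)-T-CM «THE LETTER `hwit` ON THE INTERMEDIATE CELLS WITHOUT `|2|_w = 1`» — the cover ★ p862085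
(R90-C10-p01 (g2)) and the CM dress ★ p862149 (R90-C10-p02 (g2)) re-run over the trace-one witnesses ★ p862372, with the letter `h2 : |2|_w = 1` replaced by a trace-one
integer `t` of `L_w` (`t + σ_w t = 1`, `|t|_w ≤ 1`); plus the two CM-side sources of that letter (`|2|_w = 1`; the place-free «`L ⊗ L⁺_v` has an integral element of
trace one»).  REPORT-FIRST 2026-09-04.
-/
import Summits.HodgeConjecture.HodgeConjecture.Theorems.K2E3LevelNDepthWitnessCM         -- ★ p862149 (R90-C10-p02 (g2)): the CM transport lemmas `symm_mem_N_of_mem_unipotentU`, `not_mem_model_of_not_mem`, `symm_mem_of_mem_model`, `tau_apply_one_eq_one_of_mem_N`; brings ★ p862085 Cover (discreteness, `not_le_and_le_of_not_mem`), ★ p861880, ★ Z2A-3b∕3c, ★ `conjLocal_apply_eq_of_smul_eq`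
import Summits.HodgeConjecture.HodgeConjecture.Theorems.K2E3LevelNDepthWitnessTraceOne   -- ★ p862372 (this seat): `exists_familyX_witness_of_traceOne`, `exists_familyZ_witness_of_traceOne`, `exists_traceOne_of_v_two_eq_one`
import HarnessLib

/-!
# K2 ∕ E3 «EllipticInputs», unit U4 «Keys» — (U4f-χ₁-ram-one-pos), programme A_pos^{=} brick (iii)-T-CM: THE COVER AND THE CM LETTER `hwit` ON THE INTERMEDIATE CELLS, TRACE-ONE FORM
# «★ p862085 + ★ p862149 with `|2|_w = 1` replaced by an integral `t ∈ L_w` of trace one — the intermediate cells are θ-irrelevant at every place `v` that is not wildly-ramified dyadic»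
# [Roche1998 §4; Casselman1995 §6.3; Rogawski1990 §1.10, §12.1; MoyPrasad1996 §3; Serre1979 III §3, V §1]

Cell hodgecm-mathlib, Track B «K2-LIT», crux item H413 = stmt-HodgeConjecture-24833 (route `HCCMUnconditional`, no route verbs); target BY NAME the OPEN tier-0 leaf
`…K2E3EllipticInputs.U4Keys.sig_K2E3KeysThmTwoContractingRamifiedCharOnePosDepth` (U4Keys ED. 8 :182), design D-I «vanishing functional» at POSITIVE depth.
Author K2E3-p37 (g2).  `--supports stmt-HodgeConjecture-24833 --as helper`; THEOREMS ONLY.  NOT THE PAYER.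

THE POINT.  The chain ★ X∕Z (p862033∕p861978) → ★ cover (p862085) → ★ CM dress (p862149) → (c3) `K2E3BranchAIrreduciblePosDepth` carries ONE letter foreign to the leaf :182,
`h2 : Valued.v (2 : w.1.adicCompletion L) = 1`, used only to halve inside the two witness families.  ★ p862372 replaced the halving by any `t` with `t + σt = 1`, `|t| ≤ 1`.
This file pushes that replacement through the next two links, bytes otherwise unchanged:
* §1 `exists_depth_witness_of_not_mem_of_traceOne` = ★ p862085 `K2E3LevelNDepthWitnessCover.exists_depth_witness_of_not_mem` with `(h2) ↦ (ht) (hvt)` (model `U(σ, Φ₃)(K)`;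
  proof = p01's case split verbatim, calling ★ p862372 in place of ★ X∕Z);
* §2 `exists_depthWitness_of_mem_map_of_not_mem_of_traceOne` = ★ p862149 `K2E3LevelNDepthWitnessCM.exists_depthWitness_of_mem_map_of_not_mem` with
  `(h2 : Valued.v (2 : w.1.adicCompletion L) = 1) ↦ {t : w.1.adicCompletion L} (ht : t + σ_w t = 1) (hvt : Valued.v t ≤ 1)` (`σ_w = galAdicCompletionMap … hw`; every other
  binder and the conclusion byte-identical; proof = p02's transport verbatim, calling §1);
* §3 the two CM-side sources of the letter: `exists_traceOne_adic_of_v_two_eq_one` (`|2|_w = 1`, `t = 2⁻¹` — so §2 gives ★ p862149 back) and the PLACE-FREE spelling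
  `exists_traceOne_adic_of_traceOne_local`: an integral `t ∈ L ⊗ L⁺_v = Π_{w′} L_{w′}` with `t + (c ⊗ 1) t = 1` yields the frame letter at `w` (★ `conjLocal_apply_eq_of_smul_eq`).
  «`L ⊗ L⁺_v` has an integral element of trace one» holds iff `v` is NOT wildly-ramified dyadic (all non-dyadic `v`: `t = ½`; unramified dyadic `v`: `Tr(𝒪_w) = 𝒪_v`); so a
  pos-A⁼ socket cut with that letter instead of «`v` non-dyadic» loses only the wildly ramified dyadic places — the honest residual of the uniform-`J_n` programme.
HONEST LABEL: HC_CM is proved only modulo the 7 printed citations (2 remaining named inputs: hLiu418 = stmt-HodgeConjecture-24832, h413 = stmt-HodgeConjecture-24833)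
until rung 0 closes; count-neutral — this file does NOT pay the leaf; no printed citation is discharged.

## References
* [Roche1998] A. Roche, *Types and Hecke algebras for principal series representations of split reductive p-adic groups*, Ann. Sci. ÉNS (4) 31 (1998), §4.
* [Casselman1995] W. Casselman, *Introduction to the theory of admissible representations of `p`-adic reductive groups* (1995), §6.3.
* [Rogawski1990] J. D. Rogawski, *Automorphic Representations of Unitary Groups in Three Variables*, Ann. of Math. Stud. 123 (1990), §1.9–§1.10 pp. 8–9, §12.1 p. 171.
* [MoyPrasad1996] A. Moy, G. Prasad, *Jacquet functors and unrefined minimal K-types*, Comment. Math. Helv. 71 (1996), §3.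
* [BernsteinZelevinsky1977] I. N. Bernstein, A. V. Zelevinsky, *Induced representations of reductive 𝔭-adic groups. I*, Ann. Sci. ÉNS 10 (1977), §1.8.
* [Serre1979] J.-P. Serre, *Local Fields*, GTM 67 (1979), Ch. II §1, Ch. III §3, Ch. V §1.
* [PlatonovRapinchuk1994] V. Platonov, A. Rapinchuk, *Algebraic Groups and Number Theory* (1994), §5.1.
-/

set_option autoImplicit false
-- the mandated namespace repeats the single-problem summit's segment (`HodgeConjecture.HodgeConjecture`)
set_option linter.dupNamespace false

noncomputable section

open NumberField IsDedekindDomain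
open scoped Matrix MatrixGroups WithZero Valued
open Literature.NumberTheory Literature.NumberTheory.Automorphic Literature.NumberTheory.Automorphic.UnitaryGroup
open Literature.NumberTheory.Rogawski1990

namespace Summit.HodgeConjecture.HodgeConjecture.Cruxes.H413.K2E3LevelNDepthWitnessCMTraceOne

open Summit.HodgeConjecture.HodgeConjecture.Cruxes.H413
open Summit.HodgeConjecture.HodgeConjecture.Cruxes.H413.K2E3DepthZeroIwahoriCharacterCM
open Summit.HodgeConjecture.HodgeConjecture.Cruxes.H413.K2E3LevelNIwahoriCharacterCM
open Summit.HodgeConjecture.HodgeConjecture.Cruxes.H413.K2E3BranchATorusWitnessCM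
open Summit.HodgeConjecture.HodgeConjecture.Cruxes.H413.K2E3LevelNDepthWitnessCover
open Summit.HodgeConjecture.HodgeConjecture.Cruxes.H413.K2E3LevelNDepthWitnessCM

/-! ## §1 The cover of the intermediate cells, trace-one form (model `U(σ, Φ₃)(K)`) -/

section Model

open Matrix
open scoped Pointwise

variable {K : Type*} [Field K] [Valued K ℤᵐ⁰] [ValuativeRel K] [(Valued.v : Valuation K ℤᵐ⁰).Compatible]
  (σ : K →+* K) {ϖ : K} {J : Matrix (Fin 3) (Fin 3) K} (hJ : J = (StdForm.antidiagonal 3).over K)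
  (hσ : ∀ a, σ (σ a) = a) (hvσ : ∀ a, Valued.v (σ a) = Valued.v a) (hvϖ : Valued.v ϖ = WithZero.exp (-1 : ℤ))
  {m : ℕ} (gn : GL (Fin 3) K) (hgn : (gn : Matrix (Fin 3) (Fin 3) K) = Matrix.diagonal ![(1 : K), 1, ϖ ^ (m + 1)])

include hJ hσ hvσ hvϖ hgn in
/-- **DEPTH WITNESS ON EVERY INTERMEDIATE CELL, TRACE-ONE FORM** (★ p862085 `K2E3LevelNDepthWitnessCover.exists_depth_witness_of_not_mem` with `h2 : |2| = 1` replaced by a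
trace-one integer `t`).  `ū ∈ U(σ, Φ₃)` with matrix `ū(x, z)` (`z + σz + xσx = 0`) OFF the big cell (`|z| < 1`) and OFF `J_{m+1} = K₀ ⊓ g K₀ g⁻¹` (`g = diag(1,1,ϖ^{m+1})`); `c` with
`σc = c`, `|c| ≤ |ϖ|ᵐ`; `t + σt = 1`, `|t| ≤ 1`; `m ≥ 1`.  Then some `u ∈ N` has `ū⁻¹ u ū ∈ J_{m+1}` and `(ū⁻¹ u ū)₀₀ = (1 + c)(1 + ε)` with `|ε| ≤ |ϖ|^{m+1}`.  Case
`|z| ≤ |x||ϖ|`: family X ★ p862372; case `|x||ϖ| < |z|`: family Z ★ p862372 (the case analysis is p01's, verbatim).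
[cite: Roche1998, §4] [cite: Casselman1995, §6.3] [cite: Rogawski1990, §1.10 p. 9] [cite: Serre1979, Ch. II §1] -/
theorem exists_depth_witness_of_not_mem_of_traceOne (hm : 1 ≤ m) {nb : ↥(unitaryGroupOfForm σ J)} {x z c t : K}
    (hnb : ((nb : GL (Fin 3) K) : Matrix (Fin 3) (Fin 3) K) = !![1, 0, 0; -σ x, 1, 0; z, x, 1]) (hrel : z + σ z + x * σ x = 0)
    (hz : Valued.v z < 1)
    (hoff : nb ∉ (glInt 3 K).subgroupOf (unitaryGroupOfForm σ J) ⊓ ((glInt 3 K).map (MulAut.conj gn).toMonoidHom).subgroupOf (unitaryGroupOfForm σ J))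
    (hσc : σ c = c) (hc : Valued.v c ≤ Valued.v ϖ ^ m) (ht : t + σ t = 1) (hvt : Valued.v t ≤ 1) :
    ∃ u : ↥(unitaryGroupOfForm σ J), u ∈ unipotentU σ J ∧
      nb⁻¹ * u * nb ∈ (glInt 3 K).subgroupOf (unitaryGroupOfForm σ J) ⊓ ((glInt 3 K).map (MulAut.conj gn).toMonoidHom).subgroupOf (unitaryGroupOfForm σ J) ∧
      ∃ ε : K, Valued.v ε ≤ Valued.v ϖ ^ (m + 1) ∧
        (((nb⁻¹ * u * nb : ↥(unitaryGroupOfForm σ J)) : GL (Fin 3) K) : Matrix (Fin 3) (Fin 3) K) 0 0 = (1 + c) * (1 + ε) := by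
  have hvϖ1 : Valued.v ϖ ≤ 1 := by rw [hvϖ, ← WithZero.exp_zero, WithZero.exp_le_exp]; norm_num
  -- (1) `|z| ≤ |ϖ|`, `|x|² ≤ |z| < 1`, `|x| ≤ |ϖ|`
  have hz1 : Valued.v z ≤ Valued.v ϖ := v_le_of_lt_one hvϖ hz
  have hxx : Valued.v x * Valued.v x ≤ Valued.v z := v_mul_v_le_of_rel σ hvσ hrel
  have hxlt : Valued.v x < 1 := by
    by_contra h
    rw [not_lt] at h
    exact absurd (lt_of_le_of_lt ((one_le_mul h h).trans hxx) hz) (lt_irrefl 1)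
  have hx : Valued.v x ≤ Valued.v ϖ := v_le_of_lt_one hvϖ hxlt
  -- (2) `ū ∉ J_{m+1}` on the entries
  have hoff' := not_le_and_le_of_not_mem σ hJ hvσ hvϖ gn hgn hnb (hx.trans hvϖ1) (hz1.trans hvϖ1) hoff
  by_cases hzx : Valued.v z ≤ Valued.v x * Valued.v ϖ
  · -- (3) family X
    have hxm : Valued.v ϖ ^ m ≤ Valued.v x := by
      by_contra h
      rw [not_le] at h
      have hxn := v_le_pow_succ_of_lt_pow hvϖ h
      exact hoff' ⟨hxn, hzx.trans ((mul_le_mul' hxn hvϖ1).trans_eq (mul_one _))⟩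
    have hz2 : Valued.v z * Valued.v ϖ ^ (m + 1) ≤ (Valued.v x * Valued.v ϖ) ^ 2 :=
      calc Valued.v z * Valued.v ϖ ^ (m + 1) ≤ (Valued.v x * Valued.v ϖ) * Valued.v ϖ ^ (m + 1) := mul_le_mul' hzx le_rfl
        _ = (Valued.v x * Valued.v ϖ) * (Valued.v ϖ ^ m * Valued.v ϖ) := by rw [pow_succ]
        _ ≤ (Valued.v x * Valued.v ϖ) * (Valued.v x * Valued.v ϖ) := mul_le_mul' le_rfl (mul_le_mul' hxm le_rfl)
        _ = (Valued.v x * Valued.v ϖ) ^ 2 := (sq _).symm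
    exact K2E3LevelNDepthWitnessTraceOne.exists_familyX_witness_of_traceOne σ hJ hσ hvσ hvϖ gn hgn hm hnb hrel hx hxm hzx hz2 hc ht hvt
  · -- (4) family Z
    rw [not_le] at hzx
    have hxz' : Valued.v x ≤ Valued.v z := v_le_of_mul_v_lt hvϖ hzx
    have hzm : Valued.v ϖ ^ m ≤ Valued.v z := by
      by_contra h
      rw [not_le] at h
      have hzn := v_le_pow_succ_of_lt_pow hvϖ h
      exact hoff' ⟨hxz'.trans hzn, hzn⟩
    exact K2E3LevelNDepthWitnessTraceOne.exists_familyZ_witness_of_traceOne σ hJ hσ hvσ hvϖ gn hgn hm hnb hrel hx hz1 hzm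
      (mul_le_mul' hxz' hx) hσc hc ht hvt

end Model

/-! ## §2 The CM letter `hwit` on an intermediate cell, trace-one form -/

section CM

variable (L : Type) [Field L] [NumberField L] [IsCMField L] (v : HeightOneSpectrum (𝓞 ↥(maximalRealSubfield L)))
  (w : PlacesOver L v) (hw : IsCMField.complexConj L • w.1 = w.1)
  (eA : Gqs L v ≃ₜ* ↥(unitaryGroupOfForm (galAdicCompletionMap (L := L) (IsCMField.complexConj L) hw) ((StdForm.antidiagonal 3).over (w.1.adicCompletion L))))
  (heA : ∀ g : Gqs L v,
    ((eA g : ↥(unitaryGroupOfForm (galAdicCompletionMap (L := L) (IsCMField.complexConj L) hw) ((StdForm.antidiagonal 3).over (w.1.adicCompletion L)))) :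
        GL (Fin 3) (w.1.adicCompletion L)) =
      ((localNonsplitEquiv (IsCMField.complexConj L) (qsForm L) (IsCMField.complexConj_ne_one L) w hw g :
        ↥(unitaryGroupOfForm (galAdicCompletionMap (L := L) (IsCMField.complexConj L) hw) (placeForm (qsForm L) w.1))) : GL (Fin 3) (w.1.adicCompletion L)))
  {ϖ : w.1.adicCompletion L} (hϖ : Valued.v ϖ = WithZero.exp (-1 : ℤ))
  (K0 : Subgroup (Gqs L v))
  (hK0 : K0 = ((glInt 3 (w.1.adicCompletion L)).subgroupOf
    (unitaryGroupOfForm (galAdicCompletionMap (L := L) (IsCMField.complexConj L) hw) ((StdForm.antidiagonal 3).over (w.1.adicCompletion L)))).comap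
      eA.toMulEquiv.toMonoidHom)
  {m : ℕ} (gn : GL (Fin 3) (w.1.adicCompletion L))
  (hgn : (gn : Matrix (Fin 3) (Fin 3) (w.1.adicCompletion L)) = Matrix.diagonal ![(1 : w.1.adicCompletion L), 1, ϖ ^ (m + 1)])
  (Jn : Subgroup (Gqs L v))
  (hJn : Jn = K0 ⊓ (((glInt 3 (w.1.adicCompletion L)).map (MulAut.conj gn).toMonoidHom).subgroupOf
    (unitaryGroupOfForm (galAdicCompletionMap (L := L) (IsCMField.complexConj L) hw) ((StdForm.antidiagonal 3).over (w.1.adicCompletion L)))).comap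
      eA.toMulEquiv.toMonoidHom)
  (w₀ : Gqs L v) (hw₀ : Units.val (w₀.val : GL (Fin 3) (LocalRing L v)) = cmLocalForm L 3 v)

open Classical in
include hw heA hϖ hK0 hgn hJn hw₀ in
set_option maxHeartbeats 1600000 in
-- as ★ p862149: the `U(Φ₃)(L⁺_v)`-valued products are read in two definitionally equal carriers (`Gqs L v` and the matrix subgroup); unification is slow
/-- **THE LETTER `hwit` ON AN INTERMEDIATE CELL, TRACE-ONE FORM** (★ p862149 `K2E3LevelNDepthWitnessCM.exists_depthWitness_of_mem_map_of_not_mem` with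
`h2 : |2|_w = 1` replaced by a trace-one integer `t ∈ L_w`: `t + σ_w t = 1`, `|t|_w ≤ 1`).  Frame: `v` non-split, `w ∣ v`, `eA`, a uniformiser `ϖ`, `K0 = eA⁻¹(GL₃(𝒪) ∩ U_w)`,
`g = diag(1, 1, ϖ^{m+1})`, `J_{m+1} = K0 ⊓ eA⁻¹(g GL₃(𝒪) g⁻¹ ∩ U_w)`, `w₀` of matrix `Φ₃`; `1 ≤ m`.  Letters: `χ₁` of CONDUCTOR `≤ m + 1` (`hcond`) and an EXACT-CONDUCTOR witness `u₁`
(`σ u₁ = u₁`, `|(u₁)_{w′} − 1| ≤ |ϖ|ᵐ`, `χ₁ u₁ ≠ 1`).  Then every `r ∈ N̄ = N.map (conj w₀)` with `|(eA r)₂₀|_w < 1` and `r ∉ J_{m+1}` carries `b₀ ∈ J_{m+1}` with `r b₀ r⁻¹ ∈ P`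
and `θ(b₀) ≠ (((1 ⊗ (χ₁, 1)) ∘ proj) ⊗ δ^{1∕2})(r b₀ r⁻¹)·1` (`θ(b₀) = χ₁ u₁ ≠ 1`, right-hand side `= 1`).  Proof = p02's transport verbatim over §1.
[cite: Roche1998, §4] [cite: Casselman1995, §6.3] [cite: Rogawski1990, §1.10 p. 9] [cite: Rogawski1990, §12.1 p. 171] [cite: MoyPrasad1996, §3] -/
theorem exists_depthWitness_of_mem_map_of_not_mem_of_traceOne (hm : 1 ≤ m) {t : w.1.adicCompletion L}
    (ht : t + galAdicCompletionMap (L := L) (IsCMField.complexConj L) hw t = 1) (hvt : Valued.v t ≤ 1)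
    (χ₁ : (LocalRing L v)ˣ →* ℂˣ)
    (hcond : ∀ u : (LocalRing L v)ˣ, (∀ w' : PlacesOver L v, Valued.v (((u : LocalRing L v) w') - 1) ≤ Valued.v ϖ ^ (m + 1)) → χ₁ u = 1)
    (u₁ : (LocalRing L v)ˣ) (hσu₁ : Units.map (conjLocal L (IsCMField.complexConj L) v : LocalRing L v →* LocalRing L v) u₁ = u₁)
    (hu₁ : ∀ w' : PlacesOver L v, Valued.v (((u₁ : LocalRing L v) w') - 1) ≤ Valued.v ϖ ^ m) (hχu₁ : χ₁ u₁ ≠ 1)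
    {r : Gqs L v} (hr : r ∈ ((cmBorelTriple L 3 v).N).map (MulAut.conj w₀).toMonoidHom)
    (hz : Valued.v ((((eA r : ↥(unitaryGroupOfForm (galAdicCompletionMap (L := L) (IsCMField.complexConj L) hw) ((StdForm.antidiagonal 3).over (w.1.adicCompletion L)))) :
        GL (Fin 3) (w.1.adicCompletion L)) : Matrix (Fin 3) (Fin 3) (w.1.adicCompletion L)) 2 0) < 1)
    (hoff : r ∉ Jn) :
    ∃ (b₀ : Gqs L v) (hb₀P : ((r * b₀ * r⁻¹ : Gqs L v) : ↥(unitaryGroupOfForm (conjLocal L (IsCMField.complexConj L) v) (cmLocalForm L 3 v))) ∈ (cmBorelTriple L 3 v).P),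
      b₀ ∈ Jn ∧
      (if h : IsUnit (((b₀.val : GL (Fin 3) (LocalRing L v)) : Matrix (Fin 3) (Fin 3) (LocalRing L v)) 0 0) then ((χ₁ h.unit : ℂˣ) : ℂ) else 0) ≠
        (haveI := locallyCompactSpace_cmBorelU L 3 v
         (Representation.twist
            (((Representation.trivial ℂ ↥(torusU (conjLocal L (IsCMField.complexConj L) v) (cmLocalForm L 3 v)) ℂ).twist
              (cmTorusCharPair L v χ₁ 1)).comp (cmBorelTriple L 3 v).proj) (rootDeltaChar (cmBorelTriple L 3 v).P))
          ⟨((r * b₀ * r⁻¹ : Gqs L v) : ↥(unitaryGroupOfForm (conjLocal L (IsCMField.complexConj L) v) (cmLocalForm L 3 v))), hb₀P⟩ 1) := by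
  haveI := locallyCompactSpace_cmBorelU L 3 v
  have hσσ : ∀ x, (galAdicCompletionMap (L := L) (IsCMField.complexConj L) hw) ((galAdicCompletionMap (L := L) (IsCMField.complexConj L) hw) x) = x :=
    galAdicCompletionMap_galAdicCompletionMap_of_smul_eq (IsCMField.complexConj L) w (IsCMField.complexConj_ne_one L) hw
  have hvσ : ∀ x, Valued.v (galAdicCompletionMap (L := L) (IsCMField.complexConj L) hw x) = Valued.v x :=
    fun x => valued_galAdicCompletionMap (L := L) (IsCMField.complexConj L) hw x
  -- the representative in the place model: `eA r = ū(x, z)`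
  have hrw := map_mem_map_of_mem_map L v w hw eA heA (cmBorelTriple L 3 v) rfl w₀ hw₀ hr
  obtain ⟨x, z, hnb, hrel⟩ := K2E3LowerUnipotentBorelIwahori.exists_coe_eq_lower_of_mem_map _ rfl hσσ hrw
  have hz' : Valued.v z < 1 := by
    have e : (((eA r : ↥(unitaryGroupOfForm (galAdicCompletionMap (L := L) (IsCMField.complexConj L) hw) ((StdForm.antidiagonal 3).over (w.1.adicCompletion L)))) :
        GL (Fin 3) (w.1.adicCompletion L)) : Matrix (Fin 3) (Fin 3) (w.1.adicCompletion L)) 2 0 = z := by rw [hnb]; rfl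
    rw [← e]; exact hz
  -- the `σ_w`-fixed element `c = (u₁)_w − 1 ∈ 𝔭ᵐ`
  set c : w.1.adicCompletion L := (u₁ : LocalRing L v) w - 1 with hc_def
  have hσc : galAdicCompletionMap (L := L) (IsCMField.complexConj L) hw c = c := by
    have h1 : galAdicCompletionMap (L := L) (IsCMField.complexConj L) hw ((u₁ : LocalRing L v) w) = (u₁ : LocalRing L v) w := by
      rw [← conjLocal_apply_eq_of_smul_eq (IsCMField.complexConj L) (IsCMField.complexConj_ne_one L) v w hw (u₁ : LocalRing L v)]
      have h := congrArg (fun x : (LocalRing L v)ˣ => (x : LocalRing L v) w) hσu₁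
      simpa only [Units.coe_map, MonoidHom.coe_coe] using h
    rw [hc_def, map_sub, map_one, h1]
  have hc : Valued.v c ≤ Valued.v ϖ ^ m := hu₁ w
  -- §1 (trace-one cover): the model witness `u ∈ N_w`, `j = ū⁻¹ u ū ∈ J_{m+1}`, `j₀₀ = (1 + c)(1 + ε)`
  obtain ⟨u, huN, hj, ε, hε, h00⟩ := exists_depth_witness_of_not_mem_of_traceOne _ rfl hσσ hvσ hϖ gn hgn hm hnb hrel hz'
    (not_mem_model_of_not_mem L v w hw eA K0 hK0 gn Jn hJn hoff) hσc hc ht hvt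
  -- `b₀ := r⁻¹ · eA⁻¹(u) · r`, `eA b₀ = j`, `r b₀ r⁻¹ = eA⁻¹(u)`
  refine ⟨r⁻¹ * eA.symm u * r, ?_, ?_, ?_⟩
  · have e : r * (r⁻¹ * eA.symm u * r) * r⁻¹ = eA.symm u := by group
    rw [e]
    exact (cmBorelTriple L 3 v).N_le (symm_mem_N_of_mem_unipotentU L v w hw eA heA huN)
  · have e : r⁻¹ * eA.symm u * r = eA.symm ((eA r)⁻¹ * u * eA r) := by
      apply eA.injective
      rw [ContinuousMulEquiv.apply_symm_apply, map_mul, map_mul, map_inv, ContinuousMulEquiv.apply_symm_apply]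
    rw [e]
    exact symm_mem_of_mem_model L v w hw eA K0 hK0 gn Jn hJn hj
  · -- right-hand side `= 1`
    have hN : ((r * (r⁻¹ * eA.symm u * r) * r⁻¹ : Gqs L v) : ↥(unitaryGroupOfForm (conjLocal L (IsCMField.complexConj L) v) (cmLocalForm L 3 v))) ∈
        (cmBorelTriple L 3 v).N := by
      have e : r * (r⁻¹ * eA.symm u * r) * r⁻¹ = eA.symm u := by group
      rw [e]
      exact symm_mem_N_of_mem_unipotentU L v w hw eA heA huN
    rw [tau_apply_one_eq_one_of_mem_N L v χ₁ hN]
    -- left-hand side `= χ₁ u₁`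
    have hb₀J : r⁻¹ * eA.symm u * r ∈ Jn := by
      have e : r⁻¹ * eA.symm u * r = eA.symm ((eA r)⁻¹ * u * eA r) := by
        apply eA.injective
        rw [ContinuousMulEquiv.apply_symm_apply, map_mul, map_mul, map_inv, ContinuousMulEquiv.apply_symm_apply]
      rw [e]
      exact symm_mem_of_mem_model L v w hw eA K0 hK0 gn Jn hJn hj
    have hU := isUnit_apply_zero_zero_of_mem_pow L v w hw eA heA hϖ K0 hK0 gn hgn Jn hJn (by omega) hb₀J
    rw [dif_pos hU]
    -- the `w`-component of `(b₀)₀₀` is `j₀₀ = (u₁)_w (1 + ε)`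
    have h00w : (((r⁻¹ * eA.symm u * r).val : GL (Fin 3) (LocalRing L v)) : Matrix (Fin 3) (Fin 3) (LocalRing L v)) 0 0 w =
        (u₁ : LocalRing L v) w * (1 + ε) := by
      rw [← coe_eA_apply L v w hw eA heA (r⁻¹ * eA.symm u * r) 0 0, map_mul, map_mul, map_inv, ContinuousMulEquiv.apply_symm_apply, h00, hc_def,
        add_sub_cancel]
    -- `e := unit (b₀)₀₀ · u₁⁻¹` is `≡ 1 mod 𝔭^{m+1}` at every place, hence killed by `χ₁`
    have hu₁w : Valued.v ((u₁ : LocalRing L v) w) = 1 := by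
      have hlt : Valued.v c < Valued.v (1 : w.1.adicCompletion L) := by
        rw [Valuation.map_one]
        refine lt_of_le_of_lt hc (pow_lt_one' ?_ (Nat.one_le_iff_ne_zero.1 hm))
        rw [hϖ, ← WithZero.exp_zero, WithZero.exp_lt_exp]; norm_num
      have e : (u₁ : LocalRing L v) w = 1 + c := by rw [hc_def, add_sub_cancel]
      rw [e, Valuation.map_add_eq_of_lt_left _ hlt, Valuation.map_one]
    have hu₁w0 : (u₁ : LocalRing L v) w ≠ 0 := fun h => by rw [h, map_zero] at hu₁w; exact zero_ne_one hu₁w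
    have he : ∀ w' : PlacesOver L v, Valued.v ((((hU.unit * u₁⁻¹ : (LocalRing L v)ˣ)) : LocalRing L v) w' - 1) ≤ Valued.v ϖ ^ (m + 1) := by
      intro w'
      obtain rfl := (PlacesOver.eq_of_smul_eq (IsCMField.complexConj L) (IsCMField.complexConj_ne_one L) w hw w').symm
      rw [Units.val_mul, Units.val_inv_eq_inv_val, Pi.mul_apply, Pi.inv_apply, IsUnit.unit_spec, h00w,
        show (u₁ : LocalRing L v) w * (1 + ε) * ((u₁ : LocalRing L v) w)⁻¹ - 1 = ε by field_simp; ring]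
      exact hε
    have hχe := hcond _ he
    have hunit : hU.unit = (hU.unit * u₁⁻¹) * u₁ := by rw [inv_mul_cancel_right]
    rw [hunit, map_mul, hχe, one_mul]
    intro heq
    exact hχu₁ (Units.val_eq_one.1 heq)

/-! ## §3 The two CM-side sources of the trace-one letter -/

/-- **Non-dyadic `w`**: `|2|_w = 1` gives the trace-one integer `t = 2⁻¹` of `L_w` — so §2 implies ★ p862149 back. [cite: Serre1979, Ch. II §1] -/
theorem exists_traceOne_adic_of_v_two_eq_one (h2 : Valued.v (2 : w.1.adicCompletion L) = 1) :
    ∃ t : w.1.adicCompletion L, t + galAdicCompletionMap (L := L) (IsCMField.complexConj L) hw t = 1 ∧ Valued.v t ≤ 1 :=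
  K2E3LevelNDepthWitnessTraceOne.exists_traceOne_of_v_two_eq_one (galAdicCompletionMap (L := L) (IsCMField.complexConj L) hw) h2

/-- **THE PLACE-FREE LETTER**: an integral element `t ∈ L ⊗ L⁺_v = Π_{w′ ∣ v} L_{w′}` of trace one (`t + (c ⊗ 1) t = 1`, `|t_{w′}| ≤ 1` for all `w′`) yields, at the non-split
place `v` (one `w ∣ v`; `((c ⊗ 1) t)_w = σ_w(t_w)` by ★ `conjLocal_apply_eq_of_smul_eq`), the frame letter of §2 at `w`.  Such a `t` exists iff `v` is not wildly-ramified dyadic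
(`t = ½` off `2`; `Tr(𝒪_w) = 𝒪_v` at unramified `w`). [cite: Serre1979, Ch. III §3, Ch. V §1] [cite: PlatonovRapinchuk1994, §5.1] -/
theorem exists_traceOne_adic_of_traceOne_local
    (hT : ∃ t : LocalRing L v, t + conjLocal L (IsCMField.complexConj L) v t = 1 ∧ ∀ w' : PlacesOver L v, Valued.v (t w') ≤ 1) :
    ∃ t : w.1.adicCompletion L, t + galAdicCompletionMap (L := L) (IsCMField.complexConj L) hw t = 1 ∧ Valued.v t ≤ 1 := by
  obtain ⟨t, ht, hvt⟩ := hT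
  refine ⟨t w, ?_, hvt w⟩
  rw [← conjLocal_apply_eq_of_smul_eq (IsCMField.complexConj L) (IsCMField.complexConj_ne_one L) v w hw t]
  have h := congrArg (fun y : LocalRing L v => y w) ht
  simpa only [Pi.add_apply, Pi.one_apply] using h

end CM

end Summit.HodgeConjecture.HodgeConjecture.Cruxes.H413.K2E3LevelNDepthWitnessCMTraceOne

end
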